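import Summits.ResolutionOfSingularities.ResolutionOfSingularities.Theorems.HilbertSamuelEliminationSigmaMaxModificationsCorridor3WLadderStrataBirths
import Summits.ResolutionOfSingularities.ResolutionOfSingularities.Theorems.HilbertSamuelEliminationSigmaMaxModificationsCorridor3RegularValueNondegenerate
import HarnessLib

/-!
# [OURS · L1 W4.2] The STRATA-half of the MOVING W-ladder ASSEMBLED FROM ITS THREE GEOMETRIC KERNELS — row (D) discharged

Crux chain w42 (`SigmaMaxModifications`, stmt-ResolutionOfSingularities-18506; skeleton `w_ladder` v5b on
`SigmaMaxModificationsCorridor3`, stmt-ResolutionOfSingularities-19249), row «stub-4 → `Moving.Wlow3CharStrataM p`», seat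
res-L1-w42-stub-4 (gen 3). With row (D) `MaxOriginMovingNondegenerate` CLOSED by res-L1-w42-stub-1 (`…Corridor3RegularValueNondegenerate`,
p505303: a maximal origin carrying an infinite chain has `ν ≠ Φ^{(N)}`), the assembly of `…Corridor3WLadderStrataBirths` (p505314)
loses its first hypothesis: `Wlow3CharStrataM p` (G1′) follows from the THREE GEOMETRIC KERNELS (b-end) `StrataCycleEndBirthsSettle`,
(c-geo) `StrataLineageInCentreIO`, (c-rep) `StrataReplayBlowupsSettle`, each stated at the origin predicate `QNe (QCharRegime p)`
(i.e. UNDER `ν ≠ Φ^{(3)}`, where the cycle package `CycleInv` of p504439 applies along the chain — and it now applies along EVERY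
chain from a maximal origin: `exists_cycleInv_chain'`). OURS (cell res-hironaka, slot W4.2); NOT statements of H. Hironaka's manuscript
[Hironaka2017] nor of [CossartJannsenSaito2020]; AI-drafted, weaker than expert review. Pure proofs; `--supports stmt-ResolutionOfSingularities-19249`.

References: CJS LNM 2270 Rem. 6.29 (1), Lemma 2.31, Thm. 6.35, Prop. 6.31 [CossartJannsenSaito2020]; tree p500484, p503069,
p503885, p504439, p505314 (this seat), p504161/p505303 (res-L1-w42-stub-1).
-/

noncomputable section

-- plan-1/idea-2 module setting kept (namespace `…Corridor3.Moving` re-enters `…Corridor3`)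
set_option linter.dupNamespace false

open CategoryTheory AlgebraicGeometry TopologicalSpace Topology
open Summit.ResolutionOfSingularities.ResolutionOfSingularities.Theorems.CampaignW42
open Literature.AlgebraicGeometry.Resolution Literature.RingTheory.HilbertSamuel
open Literature.AlgebraicGeometry.CossartJannsenSaito2020
open Summit.ResolutionOfSingularities.ResolutionOfSingularities.Theorems.SigmaMaxModificationsCorridor3

universe u

namespace Summit.ResolutionOfSingularities.ResolutionOfSingularities.Theorems.SigmaMaxModificationsCorridor3.Moving

variable {R : ∀ S : Scheme.{u}, CentreSeq S → Prop} {N : ℕ} {ν : ℕ → ℕ}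

/-- **Along EVERY chain of canonical near steps from a maximal origin `ν ≠ Φ^{(N)}` holds and the cycle invariant is available**
(functional admissible oracle): the regular value carries no infinite chain (res-L1-w42-stub-1, p504161/p505303), and `CycleInv`
propagates (p504439). Row provers of the moving W-ladder may therefore use `CycleInv.centre` (regular permissible centres in the
strata, `H^N` non-increasing), `.stateGood`, `.isClosed_hsStratum`, `StepProjection.image_hsStratum_subset`, … unconditionally.
[cite: CossartJannsenSaito2020, Lemma 2.31, Rem. 6.29 (1)] -/
theorem exists_cycleInv_chain' {p : ℕ} (hRf : OracleFunctional R) (hRa : OracleAdmissible R) {X : Scheme.{u}}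
    [IsLocallyNoetherian X] {x : X} (hX : IsMaximalOrigin p N ν X x) {c : ℕ → MarkedStage.{u}}
    (h0 : Reaches R N ν (MarkedStage.init X x) (c 0)) (hstep : ∀ n, CanonicalNearStep R N ν (c n) (c (n + 1))) :
    ν ≠ iterPSum N Phi ∧ ∃ (k : Type u) (_ : Field k), ∀ n, CycleInv k R N ν (c n) :=
  have hν : ν ≠ iterPSum N Phi := fun hν =>
    hX.noNearChainFrom_of_eq_iterPSum hRa hν (fun _ => True) ⟨c, h0, hstep, fun _ => trivial⟩
  have _ := hRf
  ⟨hν, exists_cycleInv_chain hRa hν hX h0 hstep⟩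

/-- **THE STRATA-HALF FROM ITS THREE GEOMETRIC KERNELS** (any origin predicate `Q`, any grade `G`): (b-end), (c-geo), (c-rep) at
`QNe Q` give «no moving, never-isolated `G`-chain from a `Q`-maximal origin». [cite: CossartJannsenSaito2020, Rem. 6.29 (1), Thm. 6.35, Prop. 6.31] -/
theorem maxOriginNoMovingNearChainAtQ_notIso_of_geometric_kernels {p N : ℕ} {Q : ℕ → (ℕ → ℕ) → ∀ X : Scheme.{u}, X → Prop}
    {G : MarkedStage.{u} → Prop} (hend : StrataCycleEndBirthsSettle p N (QNe Q) G)
    (hgeo : StrataLineageInCentreIO p N (QNe Q) G) (hrep : StrataReplayBlowupsSettle p N (QNe Q) G) :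
    MaxOriginNoMovingNearChainAtQ p N Q fun s => G s ∧ ¬ Iso N s :=
  maxOriginNoMovingNearChainAtQ_notIso_of_kernels (maxOriginMovingNondegenerate p N) hend hgeo hrep

/-- **`Wlow3CharStrataM p` (G1′) FROM THE THREE GEOMETRIC KERNELS** at `N = 3`, `Q = QCharRegime p`, `G = (ē ≤ 2)` — by name.
[cite: CossartJannsenSaito2020, Thm. 6.35, Prop. 6.31, Rem. 6.29 (1)] -/
theorem wlow3CharStrataM_of_geometric_kernels {p : ℕ}
    (hend : StrataCycleEndBirthsSettle.{0} p 3 (QNe (Helpers.QCharRegime p)) fun s => s.geomDirDim ≤ 2)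
    (hgeo : StrataLineageInCentreIO.{0} p 3 (QNe (Helpers.QCharRegime p)) fun s => s.geomDirDim ≤ 2)
    (hrep : StrataReplayBlowupsSettle.{0} p 3 (QNe (Helpers.QCharRegime p)) fun s => s.geomDirDim ≤ 2) :
    Wlow3CharStrataM p :=
  maxOriginNoMovingNearChainAtQ_notIso_of_geometric_kernels hend hgeo hrep

/-- **`WlowStrataM p` (G1′, regime-free) FROM THE THREE GEOMETRIC KERNELS** (`Q = ⊤`). [cite: CossartJannsenSaito2020, Thm. 6.35, Prop. 6.31] -/
theorem wlowStrataM_of_geometric_kernels {p : ℕ}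
    (hend : StrataCycleEndBirthsSettle.{0} p 3 (QNe fun _ _ _ _ => True) fun s => s.geomDirDim ≤ 2)
    (hgeo : StrataLineageInCentreIO.{0} p 3 (QNe fun _ _ _ _ => True) fun s => s.geomDirDim ≤ 2)
    (hrep : StrataReplayBlowupsSettle.{0} p 3 (QNe fun _ _ _ _ => True) fun s => s.geomDirDim ≤ 2) :
    WlowStrataM p :=
  maxOriginNoMovingNearChainAt_of_atQ_true (maxOriginNoMovingNearChainAtQ_notIso_of_geometric_kernels hend hgeo hrep)

/-- **`Wlow3CharM p` (the registered row `stub_Wlow3M_char`'s content) FROM THE F-KEY, THE TWO UNITS-HALF SOCKETS AND THE THREE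
STRATA KERNELS.** [cite: CossartJannsenSaito2020, Thm. 6.40, Cor. 6.37, Thm. 6.35] -/
theorem wlow3CharM_of_extraction_of_geometric_kernels {p : ℕ} (hK : KeyTheorem640_char_isolated.{0})
    (hlow : IsoLowDirDimTerminatesM p) (hext : UnitTowerExtractionQM p)
    (hend : StrataCycleEndBirthsSettle.{0} p 3 (QNe (Helpers.QCharRegime p)) fun s => s.geomDirDim ≤ 2)
    (hgeo : StrataLineageInCentreIO.{0} p 3 (QNe (Helpers.QCharRegime p)) fun s => s.geomDirDim ≤ 2)
    (hrep : StrataReplayBlowupsSettle.{0} p 3 (QNe (Helpers.QCharRegime p)) fun s => s.geomDirDim ≤ 2) : Wlow3CharM.{0} p :=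
  wlow3CharM_assembled hK hlow hext (wlow3CharStrataM_of_geometric_kernels hend hgeo hrep)

end Summit.ResolutionOfSingularities.ResolutionOfSingularities.Theorems.SigmaMaxModificationsCorridor3.Moving

end
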